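import Mathlib.Analysis.InnerProductSpace.PiL2
import Mathlib.Algebra.Module.ZLattice.Basic
import Mathlib.Topology.Algebra.InfiniteSum.Basic
import Mathlib.Topology.Algebra.Support
import Mathlib.Order.Filter.AtTopBot.Basic
import HarnessLib

/-!
# The crystallization conjecture (Blanc–Lewin formulation; Lennard-Jones in `ℝ³`)

Topic: `Literature/MathematicalPhysics/StatisticalMechanics`. Definition request
`defn-Crystallization`: conjunct `Crystallization` of the tier-2 summit `AtomisticToContinuum`
(D-0013, `Summits/AtomisticToContinuum/Statement.lean`).

## Content

For a pair potential `V : ℝ → ℝ` and particles in `E = ℝᵈ` (`EuclideanSpace ℝ (Fin d)`):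

* `interactionEnergy V x = ∑_{i<j} V(|xᵢ - xⱼ|)` for a finite configuration `x : Fin N → ℝᵈ`
  (Blanc–Lewin 2015, (1)); `groundStateEnergy V d N = E(N) = inf` over configurations of `N`
  *distinct* points (Blanc–Lewin 2015, (2)); `IsGroundState`.
* `PeriodicConfiguration d`: a full-rank lattice `G ⊂ ℝᵈ` (Mathlib `IsZLattice`) together with a
  finite non-empty motif `F` of points pairwise inequivalent mod `G`; its point set `F + G` and its
  `energyPerParticle V = (2·#F)⁻¹ ∑_{x ∈ F} ∑_{y ∈ F+G, y ≠ x} V(|x - y|)` (Blanc–Lewin 2015,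
  §2.1, (17)–(18) and (23) for Bravais lattices `F = {y}`).
* `IsCrystallizing V d` — **the crystallization conjecture in the formulation of Blanc–Lewin
  2015, §2.1, (15)–(17)**: for every sequence of ground states `x^N`, after extraction of a
  subsequence `N_j` and translation by vectors `τ_j`, the empirical measures
  `μ_{N_j}(· - τ_j) = ∑ᵢ δ_{xᵢ + τ_j}` converge *locally* (vaguely: against every continuous
  compactly supported test function) to a non-zero *periodic* locally finite point measure
  `μ = ∑_{s ∈ F+G} m(s) δ_s` (invariant under a full-rank lattice `G`).
* `HasPeriodicGroundStateEnergy V d` — the energetic form: `E(N)/N` converges to the minimum of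
  the energy per particle over periodic configurations, and that minimum is attained
  (Blanc–Lewin 2015, §1.3 (8) for `e_∞ = lim E(N)/N`; this is the form in which the
  two-dimensional results reviewed in §2.3 (Theil 2006) are stated).
* `lennardJones r = (1/12) r⁻¹² - (1/6) r⁻⁶` (Blanc–Lewin 2015, (3), with `r₀ = 1`).
* `Crystallization : Prop` — the conjunct requested by D-0013:
  `HasPeriodicGroundStateEnergy lennardJones 3 ∧ IsCrystallizing lennardJones 3`.

## Sources

* X. Blanc, M. Lewin, *The crystallization conjecture: a review*, EMS Surv. Math. Sci. 2 (2015),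
  255–306, arXiv:1504.01153: §1.1 (1)–(3), §1.2, §1.3 (8)–(9), §2.1 (15)–(18), (23), §2.2, §2.3.
* F. Theil, *A proof of crystallization in two dimensions*, Comm. Math. Phys. 262 (2006),
  209–236 (the `d = 2` energy statement, cited for the form of `HasPeriodicGroundStateEnergy`).

## Design choices and wording risks (read before use)

* **Distinct points instead of `V(0) = +∞`.** `V` is real-valued, so a hard core cannot be
  encoded by `V(0) = +∞`; instead `E(N)` is the infimum over *injective* configurations and ground
  states are injective by definition. For Lennard-Jones this is the intended problem.
* **`⨅` junk.** `groundStateEnergy` is a conditionally complete infimum: it is the true infimum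
  when the energies are bounded below (automatic when `V` is bounded below, e.g. Lennard-Jones,
  `V_LJ ≥ -1/12`; `groundStateEnergy_le`), and the junk value `0` otherwise or when `d = 0`,
  `N ≥ 2` (no injective configuration).
* **`∑'` junk.** `energyPerParticle` uses `tsum`, which is `0` for a non-summable lattice sum;
  for Lennard-Jones in `d = 3` every periodic configuration has an absolutely summable energy
  (`r⁻⁶` tail), so no junk value enters `Crystallization`.
* **Existence of ground states is not asserted.** `IsCrystallizing` quantifies over sequences of
  ground states `(x^N)_N`; for Lennard-Jones ground states exist for every `N` (Blanc–Lewin 2015,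
  §1.2: strict binding inequalities + continuity), which is a theorem we do not vendor here; for
  a potential without ground states `IsCrystallizing` would hold vacuously.
* **Non-triviality of the limit.** Blanc–Lewin ask for a periodic locally finite limit `μ`; we
  additionally require `μ ≠ 0` (non-empty motif, multiplicities `≥ 1`), since otherwise
  translating to infinity gives the periodic limit `μ = 0` and the statement is trivial. Vague
  limits of empirical measures are point measures with integer multiplicities, whence the form
  `∑ m(s) δ_s`; multiplicity `m ≡ 1` is *not* imposed (for Lennard-Jones it follows from the
  uniform lower bound on inter-particle distances in ground states, Blanc–Lewin 2015, §2.2).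
* **Only translations, and a subsequence**, exactly as in Blanc–Lewin (16); rotations are not
  needed (a subsequence of rotations converges and a rotated periodic measure is periodic).
* **Which lattice is NOT claimed** (FCC vs HCP vs other stackings differ for Lennard-Jones only in
  far neighbours; Blanc–Lewin 2015, §2.3): the statement is "some periodic configuration".
* The conjunction `Crystallization = energy form ∧ Blanc–Lewin form` for Lennard-Jones in `d = 3`
  is the summit's editorial choice (docs/m5/PROBLEMS.md, AtomisticToContinuum); both conjuncts
  are separately named and cited here.
* **Predicates, not named facts.** `HasPeriodicGroundStateEnergy V d` and `IsCrystallizing V d`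
  take the potential and the dimension as explicit binders: they are the *statements* of the
  two forms of the crystallization conjecture, to be instantiated (`lennardJones`, `3`), and
  admit no uniform proof (`not_isCrystallizing_zero` in the appendix refutes the universal
  closure; Blanc–Lewin 2015, §2.3: open for Lennard-Jones in `d = 3`). They are therefore not
  literature debt of the form `def X : Prop` awaiting `X_holds`.
-/

noncomputable section

open scoped BigOperators Topology
open Filter Set

namespace Literature.MathematicalPhysics.StatisticalMechanics

/-! ## Finite configurations and the ground-state energy `E(N)` -/

section Finite

variable (V : ℝ → ℝ) {d N : ℕ}

/-- The interaction energy `𝓔_N(x₁,…,x_N) = ∑_{1 ≤ i < j ≤ N} V(|xᵢ - xⱼ|)` of a finite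
configuration of particles interacting through the pair potential `V` (Blanc–Lewin 2015, (1)).
[cite: BlancLewin2015, §1.1 (1)] -/
def interactionEnergy (x : Fin N → EuclideanSpace ℝ (Fin d)) : ℝ :=
  ∑ i, ∑ j ∈ Finset.Ioi i, V (dist (x i) (x j))

variable (d N)

/-- The ground-state energy `E(N) = inf 𝓔_N` over configurations of `N` distinct points in `ℝᵈ`
(Blanc–Lewin 2015, (2)); distinctness replaces the convention `V(0) = +∞`. A conditionally
complete infimum: meaningful when the energies are bounded below (e.g. `V` bounded below), junk
value `0` otherwise. [cite: BlancLewin2015, §1.1 (2)] -/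
def groundStateEnergy : ℝ :=
  ⨅ x : {x : Fin N → EuclideanSpace ℝ (Fin d) // Function.Injective x}, interactionEnergy V x.1

variable {d N}

/-- `x` is a ground state (a minimiser for `E(N)`): `N` distinct points whose energy is `E(N)`
(Blanc–Lewin 2015, §1.2). [cite: BlancLewin2015, §1.2] -/
def IsGroundState (x : Fin N → EuclideanSpace ℝ (Fin d)) : Prop :=
  Function.Injective x ∧ interactionEnergy V x = groundStateEnergy V d N

/-- With at most one particle there is no interaction. [folklore] -/
theorem interactionEnergy_of_subsingleton [Subsingleton (Fin N)]
    (x : Fin N → EuclideanSpace ℝ (Fin d)) : interactionEnergy V x = 0 := by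
  refine Finset.sum_eq_zero fun i _ => Finset.sum_eq_zero fun j hj => ?_
  exact absurd (Subsingleton.elim i j ▸ Finset.mem_Ioi.1 hj) (lt_irrefl _)

/-- A pair potential bounded below by `c` gives `𝓔_N ≥ c · N(N-1)/2`; in particular the energies
are bounded below (Blanc–Lewin 2015, §1.3, stability for bounded-below potentials).
[cite: BlancLewin2015, §1.3] -/
theorem le_interactionEnergy_of_le {c : ℝ} (hc : ∀ r, c ≤ V r)
    (x : Fin N → EuclideanSpace ℝ (Fin d)) :
    ∑ i : Fin N, ((Finset.Ioi i).card : ℝ) * c ≤ interactionEnergy V x := by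
  refine Finset.sum_le_sum fun i _ => ?_
  calc ((Finset.Ioi i).card : ℝ) * c = ∑ _j ∈ Finset.Ioi i, c := by
        rw [Finset.sum_const, nsmul_eq_mul]
    _ ≤ ∑ j ∈ Finset.Ioi i, V (dist (x i) (x j)) := Finset.sum_le_sum fun j _ => hc _

/-- `E(N) ≤ 𝓔_N(x)` for every configuration `x` of distinct points, provided the energies of
injective configurations are bounded below. [cite: BlancLewin2015, §1.1 (2)] -/
theorem groundStateEnergy_le
    (hb : BddBelow (Set.range fun x : {x : Fin N → EuclideanSpace ℝ (Fin d) //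
      Function.Injective x} => interactionEnergy V x.1))
    {x : Fin N → EuclideanSpace ℝ (Fin d)} (hx : Function.Injective x) :
    groundStateEnergy V d N ≤ interactionEnergy V x :=
  ciInf_le hb ⟨x, hx⟩

/-- For a potential bounded below, `E(N) ≤ 𝓔_N(x)` for every configuration of distinct points.
[cite: BlancLewin2015, §1.3] -/
theorem groundStateEnergy_le_of_le {c : ℝ} (hc : ∀ r, c ≤ V r)
    {x : Fin N → EuclideanSpace ℝ (Fin d)} (hx : Function.Injective x) :
    groundStateEnergy V d N ≤ interactionEnergy V x :=
  groundStateEnergy_le V ⟨_, by rintro _ ⟨y, rfl⟩; exact le_interactionEnergy_of_le V hc y.1⟩ hx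

end Finite

/-! ## Periodic configurations -/

/-- A periodic (multi-lattice, "crystalline") configuration in `ℝᵈ`: a full-rank lattice `G`
(a discrete subgroup generated by `d` independent vectors — Mathlib `IsZLattice`) and a finite
non-empty motif `F` of points pairwise inequivalent modulo `G`; its point set is `F + G`, the
superposition of the shifted Bravais lattices `y + G`, `y ∈ F` (Blanc–Lewin 2015, §2.1,
(17)–(18) and the paragraph following (18)). A Bravais (mono-atomic) lattice is the case
`#F = 1`. [cite: BlancLewin2015, §2.1 (17)–(18)] -/
structure PeriodicConfiguration (d : ℕ) where
  /-- the lattice of periods `G` -/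
  lattice : Submodule ℤ (EuclideanSpace ℝ (Fin d))
  /-- `G` is discrete -/
  discrete : DiscreteTopology lattice
  /-- `G` has full rank (spans `ℝᵈ`) -/
  isZLattice : IsZLattice ℝ lattice
  /-- the motif: one representative of each `G`-orbit of points -/
  motif : Finset (EuclideanSpace ℝ (Fin d))
  /-- there is at least one particle per cell -/
  motif_nonempty : motif.Nonempty
  /-- motif points are pairwise inequivalent modulo `G` -/
  eq_of_sub_mem : ∀ x ∈ motif, ∀ y ∈ motif, x - y ∈ lattice → x = y

namespace PeriodicConfiguration

variable {d : ℕ} (P : PeriodicConfiguration d)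

attribute [instance] PeriodicConfiguration.discrete PeriodicConfiguration.isZLattice

/-- The point set `F + G = {y + g | y ∈ F, g ∈ G}` of a periodic configuration
(Blanc–Lewin 2015, §2.1 (18) ff.). [cite: BlancLewin2015, §2.1 (18)] -/
def points : Set (EuclideanSpace ℝ (Fin d)) :=
  {z | ∃ y ∈ P.motif, ∃ g ∈ P.lattice, z = y + g}

/-- Motif points are points of the configuration. [folklore] -/
theorem mem_points_of_mem_motif {y : EuclideanSpace ℝ (Fin d)} (hy : y ∈ P.motif) :
    y ∈ P.points :=
  ⟨y, hy, 0, P.lattice.zero_mem, (add_zero y).symm⟩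

/-- The point set is invariant under the lattice of periods: `μ(· + g) = μ`
(Blanc–Lewin 2015, §2.1 (17)). [cite: BlancLewin2015, §2.1 (17)] -/
theorem add_mem_points {z g : EuclideanSpace ℝ (Fin d)} (hz : z ∈ P.points) (hg : g ∈ P.lattice) :
    z + g ∈ P.points := by
  obtain ⟨y, hy, g', hg', rfl⟩ := hz
  exact ⟨y, hy, g' + g, P.lattice.add_mem hg' hg, (add_assoc _ _ _)⟩

/-- The point set is non-empty. [folklore] -/
theorem points_nonempty : P.points.Nonempty :=
  let ⟨y, hy⟩ := P.motif_nonempty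
  ⟨y, P.mem_points_of_mem_motif hy⟩

variable (V : ℝ → ℝ)

/-- The energy per particle of a periodic configuration,
`e(F + G) = (2·#F)⁻¹ ∑_{x ∈ F} ∑_{y ∈ F + G, y ≠ x} V(|x - y|)`; for a Bravais lattice
(`F = {y}`) this is `½ ∑_{g ∈ G ∖ {0}} V(|g|)` (Blanc–Lewin 2015, (23)). The inner lattice sum
is a `tsum` (junk value `0` if not summable; absolutely summable for Lennard-Jones in `d = 3`).
[cite: BlancLewin2015, §2.1 (23)] -/
def energyPerParticle : ℝ :=
  (2 * (P.motif.card : ℝ))⁻¹ *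
    ∑ x ∈ P.motif, ∑' y : {y : EuclideanSpace ℝ (Fin d) // y ∈ P.points ∧ y ≠ x}, V (dist x y.1)

end PeriodicConfiguration

/-! ## The conjectures -/

section Conjectures

/-- **Crystallization, energetic form**: the ground-state energy per particle
`e_∞ = lim_{N → ∞} E(N)/N` (Blanc–Lewin 2015, §1.3 (8)) exists and equals the *minimum* of the
energy per particle over periodic configurations, the minimum being attained: there is a
periodic configuration `P` with `e(P) = min_Q e(Q)` and `E(N)/N → e(P)`. This is the form of
the statement proved in two dimensions for Lennard-Jones-like potentials (Theil 2006; reviewed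
in Blanc–Lewin 2015, §2.3) and open in three dimensions.
[cite: BlancLewin2015, §1.3 (8) and §2.3] -/
def HasPeriodicGroundStateEnergy (V : ℝ → ℝ) (d : ℕ) : Prop :=
  ∃ P : PeriodicConfiguration d,
    IsLeast (Set.range fun Q : PeriodicConfiguration d => Q.energyPerParticle V)
      (P.energyPerParticle V) ∧
    Tendsto (fun N : ℕ => groundStateEnergy V d N / N) atTop (𝓝 (P.energyPerParticle V))

/-- **The crystallization conjecture in the formulation of Blanc–Lewin** (2015, §2.1,
(15)–(17)): for every sequence `(x^N)_N` of ground states, denoting by `μ_N = ∑ᵢ δ_{xᵢᴺ}` the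
empirical measure (15), there are a subsequence `N_j → ∞` and translations `τ_j ∈ ℝᵈ` such that
`μ_{N_j}(· - τ_j) ⇀ μ` *locally* (16), i.e. `∑ᵢ f(xᵢ^{N_j} + τ_j) → ∫ f dμ` for every continuous
compactly supported `f`, where `μ` is a *periodic* (17) locally finite measure — here: a
non-zero periodic point measure `μ = ∑_{s ∈ F + G} m(s) δ_s` carried by a periodic configuration
`F + G` with `G`-periodic integer multiplicities `m ≥ 1` (see the module docstring for why
`μ ≠ 0` is imposed and `m ≡ 1` is not). [cite: BlancLewin2015, §2.1 (15)–(17)] -/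
def IsCrystallizing (V : ℝ → ℝ) (d : ℕ) : Prop :=
  ∀ x : (N : ℕ) → (Fin N → EuclideanSpace ℝ (Fin d)), (∀ N, IsGroundState V (x N)) →
    ∃ (φ : ℕ → ℕ) (τ : ℕ → EuclideanSpace ℝ (Fin d)) (P : PeriodicConfiguration d)
      (m : EuclideanSpace ℝ (Fin d) → ℕ),
      StrictMono φ ∧
      (∀ s ∈ P.points, 1 ≤ m s) ∧
      (∀ g ∈ P.lattice, ∀ s, m (s + g) = m s) ∧
      ∀ f : EuclideanSpace ℝ (Fin d) → ℝ, Continuous f → HasCompactSupport f →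
        Tendsto (fun j => ∑ i : Fin (φ j), f (x (φ j) i + τ j)) atTop
          (𝓝 (∑' s : P.points, (m s : ℝ) * f s))

end Conjectures

/-! ## Lennard-Jones and the `AtomisticToContinuum` conjunct -/

/-- The Lennard-Jones pair potential `V_LJ(r) = (1/12)(r₀/r)¹² - (1/6)(r₀/r)⁶` in the
normalisation of Blanc–Lewin 2015, (3), with equilibrium distance `r₀ = 1` (so `min V_LJ =
V_LJ(1) = -1/12`); by scaling of lengths and energies the crystallization problem does not depend
on `r₀ > 0` or on the two positive coefficients. (`V_LJ(0) = 0` by `0⁻¹ = 0`, irrelevant since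
configurations consist of distinct points.) [cite: BlancLewin2015, §1.1 (3)] -/
def lennardJones (r : ℝ) : ℝ :=
  (1 / 12) * (r⁻¹) ^ 12 - (1 / 6) * (r⁻¹) ^ 6

/-- `V_LJ(1) = -1/12`, the minimum value of the Lennard-Jones potential
(Blanc–Lewin 2015, (3)). [cite: BlancLewin2015, §1.1 (3)] -/
theorem lennardJones_one : lennardJones 1 = -1 / 12 := by
  norm_num [lennardJones]

/-- The Lennard-Jones potential is bounded below by `-1/12`:
`(1/12)u² - (1/6)u + 1/12 = (1/12)(u - 1)² ≥ 0` with `u = r⁻⁶` (Blanc–Lewin 2015, (3)).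
[cite: BlancLewin2015, §1.1 (3)] -/
theorem neg_one_div_le_lennardJones (r : ℝ) : -1 / 12 ≤ lennardJones r := by
  have h : (0 : ℝ) ≤ (1 / 12) * ((r⁻¹) ^ 6 - 1) ^ 2 := by positivity
  unfold lennardJones
  nlinarith [h]

/-- Hence `E(N) ≤ 𝓔_N(x)` for Lennard-Jones and every configuration of distinct points (the
infimum defining `E(N)` is a genuine one). [cite: BlancLewin2015, §1.3] -/
theorem groundStateEnergy_lennardJones_le {d N : ℕ} {x : Fin N → EuclideanSpace ℝ (Fin d)}
    (hx : Function.Injective x) :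
    groundStateEnergy lennardJones d N ≤ interactionEnergy lennardJones x :=
  groundStateEnergy_le_of_le lennardJones neg_one_div_le_lennardJones hx

/-- **Crystallization** (conjunct of the summit `AtomisticToContinuum`, D-0013): for the
Lennard-Jones potential in `ℝ³`, (i) the ground-state energy per particle `lim E(N)/N` equals
the minimum of the energy per particle over periodic configurations
(`HasPeriodicGroundStateEnergy`), and (ii) ground states converge locally, along subsequences and
up to translations, to a non-trivial lattice-periodic configuration (`IsCrystallizing`, the
Blanc–Lewin formulation). Which periodic configuration (FCC, HCP, …) is not part of the claim.
Open (Blanc–Lewin 2015, §2.3: "completely open in dimension three").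
[cite: BlancLewin2015, §2.1 (15)–(17)] -/
def Crystallization : Prop :=
  HasPeriodicGroundStateEnergy lennardJones 3 ∧ IsCrystallizing lennardJones 3

end Literature.MathematicalPhysics.StatisticalMechanics

end

/-! ## Appendix: `IsCrystallizing` is a genuine, potential-dependent condition (no uniform discharge)

`IsCrystallizing V d` is the *statement* of the crystallization conjecture for the potential `V`
in dimension `d` (Blanc–Lewin 2015, §2.1 (15)–(17)); for Lennard-Jones in `d = 3` it is open
(Blanc–Lewin 2015, §2.3: "completely open in dimension three"), and even in `d = 1` the local
convergence (16) is known only for special potentials (Gardner–Radin 1979 for `V_LJ`). The block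
below certifies inside Lean that the predicate is not a consequence of the definitions: its
universal closure fails, `¬ IsCrystallizing 0 d` for every `d ≥ 1` (`not_isCrystallizing_zero`).
For the zero potential every configuration of distinct points is a ground state; the ground states
`x^N = (e/1, e/2, …, e/N)` accumulate in the unit ball, so a translated subsequence either escapes
every compact set (limit `0`, excluded by `m ≥ 1` on the non-empty point set) or piles `N_j → ∞`
particles into a fixed ball (no locally finite limit). On the way: a periodic configuration has
finitely many points in every bounded set (`PeriodicConfiguration.finite_inter_points`), so the
limit functional `f ↦ ∑' m(s) f(s)` is a finite sum on compactly supported `f`.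
-/

noncomputable section

open scoped BigOperators Topology
open scoped Pointwise
open Filter Set Metric

namespace Literature.MathematicalPhysics.StatisticalMechanics

variable {d : ℕ}

namespace PeriodicConfiguration

variable (P : PeriodicConfiguration d)

/-- A periodic configuration is locally finite: only finitely many of its points lie in a
bounded set (the lattice of periods is a discrete, hence closed, subgroup of `ℝᵈ`, and the motif
is finite). [folklore] -/
theorem finite_inter_points {K : Set (EuclideanSpace ℝ (Fin d))} (hK : Bornology.IsBounded K) :
    (K ∩ P.points).Finite := by
  have hL : ∀ y : EuclideanSpace ℝ (Fin d),
      ((K - {y}) ∩ (P.lattice : Set (EuclideanSpace ℝ (Fin d)))).Finite := fun y => by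
    have : DiscreteTopology (P.lattice : Set (EuclideanSpace ℝ (Fin d))) := P.discrete
    refine Metric.finite_isBounded_inter_isClosed DiscreteTopology.isDiscrete
      (hK.sub (Bornology.isBounded_singleton (x := y))) ?_
    rw [← Submodule.coe_toAddSubgroup]
    exact AddSubgroup.isClosed_of_discrete
  refine ((P.motif.finite_toSet.biUnion fun y _ => (hL y).image fun g => y + g).subset ?_)
  rintro z ⟨hzK, y, hy, g, hg, rfl⟩
  refine Set.mem_biUnion hy ⟨g, ⟨?_, hg⟩, rfl⟩
  exact ⟨y + g, hzK, y, rfl, add_sub_cancel_left y g⟩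

/-- Hence, for a compactly supported test function `f` and multiplicities `m`, the family
`s ↦ m(s) f(s)` on the point set has finite support … [folklore] -/
theorem finite_support_mul {f : EuclideanSpace ℝ (Fin d) → ℝ} (hf : HasCompactSupport f)
    (m : EuclideanSpace ℝ (Fin d) → ℕ) :
    (Function.support fun s : P.points => (m s : ℝ) * f s).Finite := by
  refine ((P.finite_inter_points hf.isCompact.isBounded).preimage
    Subtype.val_injective.injOn).subset ?_
  intro s hs
  exact ⟨subset_tsupport f (right_ne_zero_of_mul hs), s.2⟩

/-- … and is therefore summable, [folklore] -/
theorem summable_mul {f : EuclideanSpace ℝ (Fin d) → ℝ} (hf : HasCompactSupport f)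
    (m : EuclideanSpace ℝ (Fin d) → ℕ) :
    Summable fun s : P.points => (m s : ℝ) * f s :=
  summable_of_hasFiniteSupport (P.finite_support_mul hf m)

/-- so that for non-negative `f` each term is bounded by the sum:
`m(s₀) f(s₀) ≤ ∑' m(s) f(s)`. [folklore] -/
theorem mul_le_tsum {f : EuclideanSpace ℝ (Fin d) → ℝ} (hf : HasCompactSupport f)
    (hf0 : ∀ z, 0 ≤ f z) (m : EuclideanSpace ℝ (Fin d) → ℕ) {s₀ : EuclideanSpace ℝ (Fin d)}
    (hs₀ : s₀ ∈ P.points) :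
    (m s₀ : ℝ) * f s₀ ≤ ∑' s : P.points, (m s : ℝ) * f s :=
  (P.summable_mul hf m).le_tsum ⟨s₀, hs₀⟩ fun _ _ => mul_nonneg (Nat.cast_nonneg _) (hf0 _)

end PeriodicConfiguration

/-- The cone bump `z ↦ max 0 (R - |z - c|)` of radius `R` centred at `c`: a continuous, compactly
supported, non-negative test function with value `R` at `c`. [folklore] -/
def coneBump (c : EuclideanSpace ℝ (Fin d)) (R : ℝ) (z : EuclideanSpace ℝ (Fin d)) : ℝ :=
  max 0 (R - dist z c)

namespace coneBump

variable (c : EuclideanSpace ℝ (Fin d)) (R : ℝ)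

/-- [folklore] -/
theorem continuous : Continuous (coneBump c R) :=
  continuous_const.max (continuous_const.sub (continuous_id.dist continuous_const))

/-- [folklore] -/
theorem nonneg (z : EuclideanSpace ℝ (Fin d)) : 0 ≤ coneBump c R z := le_max_left _ _

/-- [folklore] -/
theorem sub_dist_le (z : EuclideanSpace ℝ (Fin d)) : R - dist z c ≤ coneBump c R z :=
  le_max_right _ _

/-- [folklore] -/
theorem apply_self : coneBump c R c = max 0 R := by simp [coneBump]

/-- [folklore] -/
theorem dist_lt_of_pos {z : EuclideanSpace ℝ (Fin d)} (h : 0 < coneBump c R z) : dist z c < R := by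
  rcases lt_max_iff.1 h with h | h
  · exact absurd h (lt_irrefl 0)
  · linarith

/-- [folklore] -/
theorem support_subset : Function.support (coneBump c R) ⊆ closedBall c R := by
  intro z hz
  rw [mem_closedBall]
  by_contra h
  exact hz (max_eq_left (by linarith [not_le.1 h]))

/-- [folklore] -/
theorem hasCompactSupport : HasCompactSupport (coneBump c R) :=
  HasCompactSupport.of_support_subset_isCompact (isCompact_closedBall c R) (support_subset c R)

end coneBump

/-- For the zero potential the interaction energy vanishes. [folklore] -/
theorem interactionEnergy_zero {N : ℕ} (x : Fin N → EuclideanSpace ℝ (Fin d)) :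
    interactionEnergy (fun _ => 0) x = 0 := by
  simp [interactionEnergy]

/-- For the zero potential `E(N) = 0`. [folklore] -/
theorem groundStateEnergy_zero (N : ℕ) : groundStateEnergy (fun _ => 0) d N = 0 := by
  simp [groundStateEnergy, interactionEnergy_zero]

/-- For the zero potential every configuration of distinct points is a ground state. [folklore] -/
theorem isGroundState_zero {N : ℕ} {x : Fin N → EuclideanSpace ℝ (Fin d)}
    (hx : Function.Injective x) : IsGroundState (fun _ => 0) x :=
  ⟨hx, by rw [interactionEnergy_zero, groundStateEnergy_zero]⟩

/-- **No uniform discharge of `IsCrystallizing`.** In every dimension `d ≥ 1` the zero potential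
does not crystallize in the sense of `IsCrystallizing`: the ground states
`x^N = (e₁/1, e₁/2, …, e₁/N)` (distinct points of the unit ball) admit no subsequence of
translates converging locally to a non-zero periodic point measure. Consequently the predicate
`IsCrystallizing V d` — the crystallization conjecture of Blanc–Lewin 2015, §2.1 (15)–(17), open
for Lennard-Jones in `d = 3` (§2.3) — is a genuine condition on `V`, and no theorem
`∀ V d, IsCrystallizing V d` exists. [folklore] -/
theorem not_isCrystallizing_zero (hd : 0 < d) : ¬ IsCrystallizing (fun _ => 0) d := by
  -- the ground states: `N` distinct points `e/(i+1)` on the first axis, all of norm `≤ 1`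
  set k : Fin d := ⟨0, hd⟩ with hk
  set x : (N : ℕ) → Fin N → EuclideanSpace ℝ (Fin d) :=
    fun N i => EuclideanSpace.single k (((i : ℕ) : ℝ) + 1)⁻¹ with hx
  have hnorm : ∀ N (i : Fin N), ‖x N i‖ ≤ 1 := fun N i => by
    have h1 : (1 : ℝ) ≤ ((i : ℕ) : ℝ) + 1 := by simp
    have : ‖x N i‖ = (((i : ℕ) : ℝ) + 1)⁻¹ := by
      simp [hx, abs_of_nonneg (zero_le_one.trans h1)]
    rw [this]
    exact inv_le_one_of_one_le₀ h1
  have hinj : ∀ N, Function.Injective (x N) := fun N i j hij => by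
    have h := congrArg (fun v : EuclideanSpace ℝ (Fin d) => v k) hij
    have h' : ((i : ℕ) : ℝ) + 1 = ((j : ℕ) : ℝ) + 1 := by simpa [hx] using h
    exact Fin.ext (Nat.cast_injective (R := ℝ) (add_right_cancel h'))
  intro hcr
  obtain ⟨φ, τ, P, m, hφ, hm, -, hlim⟩ := hcr x fun N => isGroundState_zero (hinj N)
  obtain ⟨s₀, hs₀⟩ := P.points_nonempty
  -- test functions: the cone bumps of radii 1 and 4 at `s₀`
  have hlim1 := hlim _ (coneBump.continuous s₀ 1) (coneBump.hasCompactSupport s₀ 1)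
  have hlim4 := hlim _ (coneBump.continuous s₀ 4) (coneBump.hasCompactSupport s₀ 4)
  set L₄ := ∑' s : P.points, (m s : ℝ) * coneBump s₀ 4 s with hL₄
  -- the limit gives mass `≥ 1` to the unit bump, so eventually a particle is within `1` of `s₀`
  have hpos : (0 : ℝ) < ∑' s : P.points, (m s : ℝ) * coneBump s₀ 1 s := by
    refine lt_of_lt_of_le ?_ (P.mul_le_tsum (coneBump.hasCompactSupport s₀ 1)
      (coneBump.nonneg s₀ 1) m hs₀)
    rw [coneBump.apply_self, max_eq_right zero_le_one, mul_one]
    exact_mod_cast hm s₀ hs₀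
  have e1 : ∀ᶠ j in atTop, (0 : ℝ) < ∑ i : Fin (φ j), coneBump s₀ 1 (x (φ j) i + τ j) :=
    hlim1.eventually (lt_mem_nhds hpos)
  have e4 : ∀ᶠ j in atTop, ∑ i : Fin (φ j), coneBump s₀ 4 (x (φ j) i + τ j) < L₄ + 1 :=
    hlim4.eventually (gt_mem_nhds (lt_add_one L₄))
  have eφ : ∀ᶠ j in atTop, L₄ + 1 ≤ (φ j : ℝ) :=
    (tendsto_natCast_atTop_atTop.comp hφ.tendsto_atTop).eventually_ge_atTop (L₄ + 1)
  obtain ⟨j, hj1, hj4, hjφ⟩ := (e1.and (e4.and eφ)).exists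
  -- at such an index: one particle within `1` of `s₀`, hence all `φ j` particles within `3`
  obtain ⟨i₀, -, hi₀⟩ := Finset.exists_lt_of_sum_lt
    (by simpa using hj1 : ∑ _i : Fin (φ j), (0 : ℝ) < ∑ i, coneBump s₀ 1 (x (φ j) i + τ j))
  have hd₀ : dist (x (φ j) i₀ + τ j) s₀ < 1 := coneBump.dist_lt_of_pos s₀ 1 hi₀
  have hall : ∀ i : Fin (φ j), 1 ≤ coneBump s₀ 4 (x (φ j) i + τ j) := fun i => by
    refine le_trans ?_ (coneBump.sub_dist_le s₀ 4 _)
    have h2 : dist (x (φ j) i + τ j) (x (φ j) i₀ + τ j) ≤ 2 := by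
      rw [dist_add_right]
      exact (dist_le_norm_add_norm _ _).trans (by linarith [hnorm _ i, hnorm _ i₀])
    linarith [dist_triangle (x (φ j) i + τ j) (x (φ j) i₀ + τ j) s₀]
  have hsum : (φ j : ℝ) ≤ ∑ i : Fin (φ j), coneBump s₀ 4 (x (φ j) i + τ j) := by
    calc (φ j : ℝ) = ∑ _i : Fin (φ j), (1 : ℝ) := by simp
      _ ≤ _ := Finset.sum_le_sum fun i _ => hall i
  linarith

end Literature.MathematicalPhysics.StatisticalMechanics

end
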